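import Mathlib
import HarnessLib
import Summits.HubbardSuperconductivity.HubbardSuperconductivity.Theorems.KLProgrammeC4aPPKernelMidBundle
import Summits.HubbardSuperconductivity.HubbardSuperconductivity.Theorems.KLProgrammeC4aPPKernelMidNeg

/-!
# Route `KLProgramme` — crux C4a, S3 brick (B4) «(B4)-UMK1», «(U1)-M-LAW» kernel side, part 10: ROW `hflatB` of the `…Middle` laws for `K := M_s/C` —
# band flatness with a Lipschitz-anchored weight, every `0 < D ≤ hi/t₁`

Cell `gate-hubbard-kl`, seat hubbard-kl-k3c3-p1 (g17; row «δμ-flow with klAngularMean constant piece»).  The `…Middle` laws (k3c3-p3 g34/g35) take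
`hflatB : ∀ D ∈ (0, D_fl], |∫_{max lo (D/(q_c+3/2))}^{min hi (4D)} wt·∂ᵤK(e,D−e) de| ≤ A_fl·lo/max(D,lo)² + B_fl`.  For `K = M_s/C` (`q_c = 2q′`, `q′ = (2−t₁)/t₁`,
`C ≥ C₁ᴹ, Cˢᴹ`) and a weight with `|wt| ≤ W` on `[−hi,hi]`, `|wt e − wt lo| ≤ W′(e−lo)` on `[lo,hi]`, this holds with `D_fl = hi/t₁`,
`A_fl = W·X_M`, `X_M = 65 + 32q′(Λ+lo)/lo + (12(1+2κ₀)/β + 4κ₁q′lo + (1+2κ₀)hi)/(C·lo)`, `B_fl = 4(2q′+3/2)·W′`: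
reversed band (`4D < lo`) by the strip row; small `D` by the unit envelope `4/D²` on a band of length `≤ 4D`; `D ≥ 2q′(Λ+lo)` by the constant-weight flatness
(p709084 `abs_midFlatness_line_le_of_ge_offZone` on `[a, max b 2D]` minus `abs_midFlatness_line_le_of_ge` on `[b, max b 2D]`); the weight's variation by
`W′(e−lo)/e² ≤ W′(q_c+3/2)/D` on a band of length `≤ 4D`.
* **`abs_midS_band_const_le`** (constant weight), **`midS_hflatB_row`** (THE ROW).
Pure real analysis; nothing asserts (C), K3, the window or superconductivity.
References: BGM 2006 §2.4 (2.36) [cite: BenfattoGiulianiMastropietro2006]; FST II CPAM 51 (1998) §3 [cite: FeldmanSalmhoferTrubowitz1998].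
-/

noncomputable section

namespace Summit.HubbardSuperconductivity.HubbardSuperconductivity.Theorems.C4a

set_option linter.dupNamespace false -- summit = problem name (single-conjunct summit), D-0017

open Real Filter Set MeasureTheory intervalIntegral
open scoped Topology Interval
open Literature.MathematicalPhysics.QuantumLattice Literature.Analysis.SpecialFunctions

section BandRow

variable {β Λ : ℝ} (hβ : 0 < β) (hΛ : 0 < Λ) {B₁ B₂ : ℝ} (hB₁ : ∀ x, |deriv salmhoferCutoff x| ≤ B₁) (hB₂ : ∀ x, |deriv (deriv salmhoferCutoff) x| ≤ B₂)
  {κ κ' : ℝ → ℝ} (hκ : ∀ t, HasDerivAt κ (κ' t) t) (hκ'c : Continuous κ')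
  {κ₀ κ₁ : ℝ} (hκb : ∀ t ∈ Icc 0 1, |κ t| ≤ κ₀) (hκ'b : ∀ t ∈ Icc 0 1, |κ' t| ≤ κ₁)
  {t₁ : ℝ} (ht₀ : 0 < t₁) (ht25 : t₁ ≤ 2 / 5)
  (hκs : ∀ t, t₁ ≤ t → κ t = 0) (hκ's : ∀ t, t₁ ≤ t → κ' t = 0) (hκ1 : ∀ t, t ≤ t₁ / 2 → κ t = 1) (hκ'1 : ∀ t, t ≤ t₁ / 2 → κ' t = 0)
  {lo hi C : ℝ} (hlo : 0 < lo) (hloΛ : lo ≤ Λ) (hC : 0 < C)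

set_option maxHeartbeats 400000 in
include hβ hΛ hB₁ hB₂ hκ hκ'c hκb hκ'b ht₀ ht25 hκs hκ's hκ1 hκ'1 hlo hloΛ hC in
/-- **The constant-weight band integral of `∂ᵤ(M_s/C)`** (`C ≥ C₁ᴹ`, `lo ≤ 4D`, `D ≤ hi/t₁`): with `q′ = (2−t₁)/t₁`,
`|∫_{max lo (D/(2q′+3/2))}^{min hi (4D)} ∂ᵤ(M_s/C)(e,D−e) de| ≤ X_M·lo/max(D,lo)²`, `X_M = 65 + 32q′(Λ+lo)/lo + (12(1+2κ₀)/β + 4κ₁q′lo + (1+2κ₀)hi)/(C·lo)`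
(small `D`: unit envelope `4/D²` on a band of length `≤ 4D`; `D ≥ 2q′(Λ+lo)`: p709084's constant-weight flatness on `[a, max b 2D]` minus `[b, max b 2D]`).
[cite: BenfattoGiulianiMastropietro2006, §2.4 (2.36)] -/
theorem abs_midS_band_const_le
    (hC1 : (1 + 2 * κ₀) * (128 * B₂ + 216 * B₁ + 294 + (48 * B₁ + 28) * ((2 - t₁) / t₁)) + 2 * κ₁ * (12 * B₁ + 9) ≤ C) (hlohi : lo ≤ hi)
    {D : ℝ} (hD : 0 < D) (hDhi : D ≤ hi / t₁) (hfwd : lo ≤ 4 * D) :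
    |∫ e in (max lo (D / (2 * ((2 - t₁) / t₁) + 3 / 2)))..(min hi (4 * D)), deriv (fun v : ℝ => ppMidKernelS β Λ κ lo e v / C) (D - e)| ≤
      (65 + 32 * ((2 - t₁) / t₁) * (Λ + lo) / lo + (12 * (1 + 2 * κ₀) / β + 4 * κ₁ * ((2 - t₁) / t₁) * lo + (1 + 2 * κ₀) * hi) / (C * lo)) *
        (lo / max D lo ^ 2) := by
  have hB0 := salmhoferB₁_nonneg hB₁
  have hB20 : 0 ≤ B₂ := (abs_nonneg _).trans (hB₂ 0)
  have hκ₀ : 0 ≤ κ₀ := (abs_nonneg _).trans (hκb 0 (left_mem_Icc.2 zero_le_one))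
  have hκ₁ : 0 ≤ κ₁ := (abs_nonneg _).trans (hκ'b 0 (left_mem_Icc.2 zero_le_one))
  set q : ℝ := (2 - t₁) / t₁ with hq
  have hq4 : 4 ≤ q := midRatio_ge_four ht₀ ht25
  set c' : ℝ := 2 * q + 3 / 2 with hc'
  have hc'0 : 0 < c' := by positivity
  have hhi0 : 0 < hi := hlo.trans_le hlohi
  set a : ℝ := max lo (D / c') with ha
  set b : ℝ := min hi (4 * D) with hb
  have hloa : lo ≤ a := le_max_left _ _
  have hDa : D / c' ≤ a := le_max_right _ _
  have hbhi : b ≤ hi := min_le_left _ _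
  have hb4 : b ≤ 4 * D := min_le_right _ _
  have ha0 : 0 < a := hlo.trans_le hloa
  have hDc : D / c' ≤ 4 * D := by rw [div_le_iff₀ hc'0]; nlinarith
  have hahi : a ≤ hi := by
    refine max_le hlohi ?_
    rw [div_le_iff₀ hc'0]
    have h1 : D * t₁ ≤ hi := by rw [le_div_iff₀ ht₀] at hDhi; linarith
    have h2 : t₁ * c' = 4 - t₁ / 2 := by rw [hc', hq]; field_simp; ring
    nlinarith
  have hab : a ≤ b := max_le (le_min hlohi hfwd) (le_min (by linarith) hDc)
  set X₃ : ℝ := (12 * (1 + 2 * κ₀) / β + 4 * κ₁ * q * lo + (1 + 2 * κ₀) * hi) / (C * lo) with hX₃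
  have hX₃0 : 0 ≤ X₃ := by positivity
  have hX1 : 0 ≤ 32 * q * (Λ + lo) / lo := by positivity
  have hmaxlo : 0 < max D lo := lt_max_of_lt_left hD
  -- the integrand
  obtain ⟨G, hGdef⟩ : ∃ G : ℝ → ℝ, G = fun e => deriv (fun v : ℝ => ppMidKernelS β Λ κ lo e v / C) (D - e) := ⟨_, rfl⟩
  have hGdiv : ∀ e, G e = deriv (fun v : ℝ => ppMidKernelS β Λ κ lo e v) (D - e) / C := fun e => by rw [hGdef]; exact deriv_div_const C
  have hGc : Continuous G := by
    have h : Continuous fun e : ℝ => deriv (fun v : ℝ => ppMidKernelS β Λ κ lo e v) (D - e) / C :=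
      ((continuous_deriv_ppMidKernelS₂ hβ hΛ hB₁ hκ hlo hκ'c (κ := κ)).comp₂ continuous_id' ((continuous_const (y := D)).sub continuous_id')).div_const C
    exact (funext hGdiv ▸ h :)
  have hGi : ∀ x y : ℝ, IntervalIntegrable G volume x y := fun x y => hGc.intervalIntegrable x y
  have hG4 : ∀ e, 0 < e → |G e| ≤ 4 / D ^ 2 := fun e he => by
    rw [hGdiv]
    refine (abs_div_le_of_le (abs_deriv_ppMidKernelS_le hβ hΛ hB₁ hB₂ hκ hκb hκ'b ht₀ ht25 hκs hκ's hκ1 hκ'1 hlo hloΛ he (D - e)) hC1 hC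
      (by positivity)).trans ?_
    have hm : D / 2 ≤ max e |D - e| := by
      rcases le_or_gt (D / 2) e with h | h
      · exact h.trans (le_max_left _ _)
      · exact le_trans (by rw [abs_of_pos (by linarith)]; linarith) (le_max_right _ _)
    rw [show 4 / D ^ 2 = (D / 2)⁻¹ ^ 2 by field_simp; norm_num]
    exact pow_le_pow_left₀ (inv_nonneg.2 ((by positivity : (0:ℝ) ≤ D / 2).trans hm)) (inv_anti₀ (by positivity) hm) 2
  have hderiv : ∀ e ∈ uIcc a b, deriv (fun v : ℝ => ppMidKernelS β Λ κ lo e v / C) (D - e) = G e := fun e _ => by rw [hGdef]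
  rw [intervalIntegral.integral_congr hderiv]
  rcases lt_or_ge D (2 * q * (Λ + lo)) with hsmall | hbig
  · -- unit envelope `4/D²` on a band of length `≤ 4D`
    have hbound : ∀ e ∈ Ι a b, ‖G e‖ ≤ 4 / D ^ 2 := fun e he => by
      rw [uIoc_of_le hab] at he
      rw [Real.norm_eq_abs]; exact hG4 e (ha0.trans he.1)
    have h := intervalIntegral.norm_integral_le_of_norm_le_const hbound
    rw [Real.norm_eq_abs, abs_of_nonneg (by linarith : 0 ≤ b - a)] at h
    refine (h.trans (mul_le_mul_of_nonneg_left (by linarith : b - a ≤ 4 * D) (by positivity))).trans ?_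
    rw [show 4 / D ^ 2 * (4 * D) = 16 / D by field_simp; ring]
    rcases le_or_gt lo D with hloD | hloD
    · rw [max_eq_left hloD]
      have h1 : 16 / D ≤ 32 * q * (Λ + lo) / lo * (lo / D ^ 2) := by
        rw [show 32 * q * (Λ + lo) / lo * (lo / D ^ 2) = 16 * (2 * q * (Λ + lo)) / D ^ 2 by field_simp; ring,
          div_le_div_iff₀ hD (pow_pos hD 2)]
        nlinarith
      have h2 : 0 ≤ (65 + X₃) * (lo / D ^ 2) := by positivity
      have h3 : (65 + 32 * q * (Λ + lo) / lo + X₃) * (lo / D ^ 2) = 32 * q * (Λ + lo) / lo * (lo / D ^ 2) + (65 + X₃) * (lo / D ^ 2) := by ring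
      rw [h3]; linarith
    · rw [max_eq_right hloD.le]
      have h1 : 16 / D ≤ 65 * (lo / lo ^ 2) := by
        rw [show lo / lo ^ 2 = 1 / lo by field_simp, show (65 : ℝ) * (1 / lo) = 65 / lo by ring, div_le_div_iff₀ hD hlo]
        nlinarith
      have h2 : 0 ≤ (32 * q * (Λ + lo) / lo + X₃) * (lo / lo ^ 2) := by positivity
      have h3 : (65 + 32 * q * (Λ + lo) / lo + X₃) * (lo / lo ^ 2) = 65 * (lo / lo ^ 2) + (32 * q * (Λ + lo) / lo + X₃) * (lo / lo ^ 2) := by ring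
      rw [h3]; linarith
  · -- `D ≥ 2q(Λ+lo)`: constant-weight flatness on `[a, max b 2D]` minus `[b, max b 2D]`
    have h8 : 8 * (Λ + lo) ≤ 2 * q * (Λ + lo) := by nlinarith [hΛ.le, hlo.le]
    have hDlo : lo < D := by linarith
    rw [max_eq_left hDlo.le]
    set b' : ℝ := max b (2 * D) with hb'
    have hbb' : b ≤ b' := le_max_left _ _
    have h2D : 2 * D ≤ b' := le_max_right _ _
    have hab' : a ≤ b' := hab.trans hbb'
    have hΦa : 2 * ((2 - t₁) / t₁) * a ≤ |D - a| := by
      rw [← hq]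
      rcases le_or_gt (D / c') lo with h | h
      · have haeq : a = lo := by rw [ha, max_eq_left h]
        rw [haeq, abs_of_nonneg (by linarith)]
        nlinarith
      · have haeq : a = D / c' := by rw [ha, max_eq_right h.le]
        have hDa' : D - D / c' = D * (c' - 1) / c' := by field_simp
        have hc1 : 0 < c' - 1 := by rw [hc']; linarith
        rw [haeq, hDa', abs_of_pos (by positivity)]
        rw [show 2 * q * (D / c') = D * (2 * q) / c' by ring, div_le_div_iff_of_pos_right hc'0]
        exact mul_le_mul_of_nonneg_left (by rw [hc']; linarith) hD.le
    have hflat1 := abs_midFlatness_line_le_of_ge_offZone hβ hΛ hB₁ hκ hκ'c hκb hκ'b ht₀ ht25 hκs hκ's hκ1 hκ'1 hlo hloΛ hbig hloa hab' h2D hΦa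
    have hflat2 := abs_midFlatness_line_le_of_ge hβ hΛ hB₁ hκ hκ'c hκb hκ'b ht₀ ht25 hκs hκ's hκ1 hκ'1 hlo hloΛ hbig (hloa.trans hab) hbb' h2D
    have hsplit : ∫ e in a..b, G e = (∫ e in a..b', G e) - ∫ e in b..b', G e := by
      rw [← intervalIntegral.integral_add_adjacent_intervals (hGi a b) (hGi b b')]; ring
    have hGint : ∀ x y : ℝ, ∫ e in x..y, G e = (∫ e in x..y, deriv (fun v : ℝ => ppMidKernelS β Λ κ lo e v) (D - e)) / C := fun x y => by
      rw [← intervalIntegral.integral_div]; exact intervalIntegral.integral_congr fun e _ => hGdiv e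
    rw [hsplit, hGint, hGint, ← sub_div, abs_div, abs_of_pos hC]
    have hD2 : 0 < D ^ 2 := pow_pos hD 2
    have hnum : |(∫ e in a..b', deriv (fun v : ℝ => ppMidKernelS β Λ κ lo e v) (D - e)) -
        ∫ e in b..b', deriv (fun v : ℝ => ppMidKernelS β Λ κ lo e v) (D - e)| ≤
        (12 * (1 + 2 * κ₀) / β + 4 * κ₁ * q * lo + (1 + 2 * κ₀) * hi) / D ^ 2 := by
      rw [le_div_iff₀ hD2]
      refine le_trans (mul_le_mul_of_nonneg_right (abs_sub _ _) hD2.le) ?_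
      have h1 := mul_le_mul_of_nonneg_left hbhi (by positivity : 0 ≤ 1 + 2 * κ₀)
      rw [← hq] at hflat1 hflat2
      have e1 : 12 * (1 + 2 * κ₀) / β = 2 * (6 * (1 + 2 * κ₀) / β) := by ring
      linarith [hflat1, hflat2, h1, e1]
    calc |(∫ e in a..b', deriv (fun v : ℝ => ppMidKernelS β Λ κ lo e v) (D - e)) -
          ∫ e in b..b', deriv (fun v : ℝ => ppMidKernelS β Λ κ lo e v) (D - e)| / C
        ≤ (12 * (1 + 2 * κ₀) / β + 4 * κ₁ * q * lo + (1 + 2 * κ₀) * hi) / D ^ 2 / C := div_le_div_of_nonneg_right hnum hC.le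
      _ = X₃ * (lo / D ^ 2) := by rw [hX₃]; field_simp
      _ ≤ (65 + 32 * q * (Λ + lo) / lo + X₃) * (lo / D ^ 2) := by
          refine mul_le_mul_of_nonneg_right ?_ (by positivity)
          linarith

set_option maxHeartbeats 400000 in
include hβ hΛ hB₁ hB₂ hκ hκ'c hκb hκ'b ht₀ ht25 hκs hκ's hκ1 hκ'1 hlo hloΛ hC in
/-- **ROW `hflatB` FOR `K := M_s/C`** (`C ≥ C₁ᴹ`, `C ≥ Cˢᴹ`; weight `|wt| ≤ W` on `[−hi,hi]`, `|wt e − wt lo| ≤ W′(e−lo)` on `[lo,hi]`; `0 < D ≤ hi/t₁`):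
`|∫_{max lo (D/(2q′+3/2))}^{min hi (4D)} wt(e)·∂ᵤK(e,D−e) de| ≤ W·X_M·lo/max(D,lo)² + 4(2q′+3/2)·W′`. [cite: BenfattoGiulianiMastropietro2006, §2.4 (2.36)] -/
theorem midS_hflatB_row
    (hC1 : (1 + 2 * κ₀) * (128 * B₂ + 216 * B₁ + 294 + (48 * B₁ + 28) * ((2 - t₁) / t₁)) + 2 * κ₁ * (12 * B₁ + 9) ≤ C)
    (hCs : (1 + 2 * κ₀) * (128 * B₁ + 72) + 16 * κ₁ ≤ C) (hlohi : lo ≤ hi)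
    {wt : ℝ → ℝ} {W W' : ℝ} (hwc : ContinuousOn wt (Icc (-hi) hi)) (hwW : ∀ e ∈ Icc (-hi) hi, |wt e| ≤ W) (hW' : 0 ≤ W')
    (hwL : ∀ e ∈ Icc lo hi, |wt e - wt lo| ≤ W' * (e - lo)) {D : ℝ} (hD : 0 < D) (hDhi : D ≤ hi / t₁) :
    |∫ e in (max lo (D / (2 * ((2 - t₁) / t₁) + 3 / 2)))..(min hi (4 * D)), wt e * deriv (fun v : ℝ => ppMidKernelS β Λ κ lo e v / C) (D - e)| ≤
      W * (65 + 32 * ((2 - t₁) / t₁) * (Λ + lo) / lo + (12 * (1 + 2 * κ₀) / β + 4 * κ₁ * ((2 - t₁) / t₁) * lo + (1 + 2 * κ₀) * hi) / (C * lo)) *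
          (lo / max D lo ^ 2) +
        4 * (2 * ((2 - t₁) / t₁) + 3 / 2) * W' := by
  have hB0 := salmhoferB₁_nonneg hB₁
  have hB20 : 0 ≤ B₂ := (abs_nonneg _).trans (hB₂ 0)
  have hκ₀ : 0 ≤ κ₀ := (abs_nonneg _).trans (hκb 0 (left_mem_Icc.2 zero_le_one))
  have hκ₁ : 0 ≤ κ₁ := (abs_nonneg _).trans (hκ'b 0 (left_mem_Icc.2 zero_le_one))
  -- the constant-weight bound, before `q` is abbreviated
  have hI0 := abs_midS_band_const_le hβ hΛ hB₁ hB₂ hκ hκ'c hκb hκ'b ht₀ ht25 hκs hκ's hκ1 hκ'1 hlo hloΛ hC hC1 hlohi hD hDhi (κ := κ)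
  set q : ℝ := (2 - t₁) / t₁ with hq
  have hq4 : 4 ≤ q := midRatio_ge_four ht₀ ht25
  set c' : ℝ := 2 * q + 3 / 2 with hc'
  have hc'0 : 0 < c' := by positivity
  have hloI : lo ∈ Icc (-hi) hi := ⟨by linarith, hlohi⟩
  have hW0 : 0 ≤ W := (abs_nonneg _).trans (hwW lo hloI)
  have hhi0 : 0 < hi := hlo.trans_le hlohi
  set a : ℝ := max lo (D / c') with ha
  set b : ℝ := min hi (4 * D) with hb
  have hloa : lo ≤ a := le_max_left _ _
  have hDa : D / c' ≤ a := le_max_right _ _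
  have hbhi : b ≤ hi := min_le_left _ _
  have hb4 : b ≤ 4 * D := min_le_right _ _
  have ha0 : 0 < a := hlo.trans_le hloa
  have hDc : D / c' ≤ 4 * D := by rw [div_le_iff₀ hc'0]; nlinarith
  have hahi : a ≤ hi := by
    refine max_le hlohi ?_
    rw [div_le_iff₀ hc'0]
    have h1 : D * t₁ ≤ hi := by rw [le_div_iff₀ ht₀] at hDhi; linarith
    have h2 : t₁ * c' = 4 - t₁ / 2 := by rw [hc', hq]; field_simp; ring
    nlinarith
  set X : ℝ := 65 + 32 * q * (Λ + lo) / lo + (12 * (1 + 2 * κ₀) / β + 4 * κ₁ * q * lo + (1 + 2 * κ₀) * hi) / (C * lo) with hX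
  have hX65 : 65 ≤ X := by
    have h1 : 0 ≤ 32 * q * (Λ + lo) / lo := by positivity
    have h2 : 0 ≤ (12 * (1 + 2 * κ₀) / β + 4 * κ₁ * q * lo + (1 + 2 * κ₀) * hi) / (C * lo) := by positivity
    rw [hX]; linarith
  have hmaxlo : 0 < max D lo := lt_max_of_lt_left hD
  -- the integrand `G e = ∂ᵤK(e, D−e)`
  obtain ⟨G, hGdef⟩ : ∃ G : ℝ → ℝ, G = fun e => deriv (fun v : ℝ => ppMidKernelS β Λ κ lo e v / C) (D - e) := ⟨_, rfl⟩
  have hGdiv : ∀ e, G e = deriv (fun v : ℝ => ppMidKernelS β Λ κ lo e v) (D - e) / C := fun e => by rw [hGdef]; exact deriv_div_const C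
  have hGc : Continuous G := by
    have h : Continuous fun e : ℝ => deriv (fun v : ℝ => ppMidKernelS β Λ κ lo e v) (D - e) / C :=
      ((continuous_deriv_ppMidKernelS₂ hβ hΛ hB₁ hκ hlo hκ'c (κ := κ)).comp₂ continuous_id' ((continuous_const (y := D)).sub continuous_id')).div_const C
    exact (funext hGdiv ▸ h :)
  have hGi : ∀ x y : ℝ, IntervalIntegrable G volume x y := fun x y => hGc.intervalIntegrable x y
  have hG1 : ∀ e, 0 < e → |G e| ≤ (max e |D - e|)⁻¹ ^ 2 := fun e he => by
    rw [hGdiv]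
    exact abs_div_le_of_le (abs_deriv_ppMidKernelS_le hβ hΛ hB₁ hB₂ hκ hκb hκ'b ht₀ ht25 hκs hκ's hκ1 hκ'1 hlo hloΛ he (D - e)) hC1 hC (by positivity)
  have hGs : ∀ e, |e| ≤ lo → |G e| ≤ lo⁻¹ ^ 2 := fun e he => by
    rw [hGdiv]
    refine (abs_div_le_of_le (abs_deriv_ppMidKernelS_strip_le hβ hΛ hB₁ hκ hκb hκ'b hlo hloΛ he (D - e)) hCs hC (by positivity)).trans ?_
    exact pow_le_pow_left₀ (inv_nonneg.2 (hlo.le.trans (le_max_left _ _))) (inv_anti₀ hlo (le_max_left _ _)) 2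
  have hderiv : ∀ e ∈ uIcc a b, wt e * deriv (fun v : ℝ => ppMidKernelS β Λ κ lo e v / C) (D - e) = wt e * G e := fun e _ => by rw [hGdef]
  have hderiv' : ∀ e ∈ uIcc a b, deriv (fun v : ℝ => ppMidKernelS β Λ κ lo e v / C) (D - e) = G e := fun e _ => by rw [hGdef]
  rw [intervalIntegral.integral_congr hderiv]
  rcases lt_or_ge (4 * D) lo with hrev | hfwd
  · -- reversed band `[4D, lo]`: strip row, length `≤ lo`
    have hbeq : b = 4 * D := by rw [hb, min_eq_right (by linarith)]
    have haeq : a = lo := by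
      rw [ha, max_eq_left]
      rw [div_le_iff₀ hc'0]; nlinarith
    rw [haeq, hbeq]
    have hbound : ∀ e ∈ Ι lo (4 * D), ‖wt e * G e‖ ≤ W * lo⁻¹ ^ 2 := fun e he => by
      rw [uIoc_of_ge hrev.le] at he
      have he0 : 0 < e := by linarith [he.1]
      rw [Real.norm_eq_abs, abs_mul]
      exact mul_le_mul (hwW e ⟨by linarith, he.2.trans hlohi⟩) (hGs e (by rw [abs_of_pos he0]; exact he.2)) (abs_nonneg _) hW0
    have h := intervalIntegral.norm_integral_le_of_norm_le_const hbound
    rw [Real.norm_eq_abs] at h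
    refine h.trans ?_
    have hlen : |4 * D - lo| ≤ lo := by rw [abs_of_neg (by linarith)]; linarith
    have hmax : max D lo = lo := max_eq_right (by linarith)
    rw [hmax]
    have h4 : 0 ≤ 4 * c' * W' := by positivity
    calc W * lo⁻¹ ^ 2 * |4 * D - lo| ≤ W * lo⁻¹ ^ 2 * lo := mul_le_mul_of_nonneg_left hlen (by positivity)
      _ = W * 1 * (lo / lo ^ 2) := by field_simp
      _ ≤ W * X * (lo / lo ^ 2) := mul_le_mul_of_nonneg_right (mul_le_mul_of_nonneg_left (by linarith) hW0) (by positivity)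
      _ ≤ W * X * (lo / lo ^ 2) + 4 * c' * W' := by linarith
  · -- forward band `a ≤ b`
    have hab : a ≤ b := max_le (le_min hlohi hfwd) (le_min (by linarith) hDc)
    have haI : a ∈ Icc lo hi := ⟨hloa, hahi⟩
    have hbI : b ∈ Icc lo hi := ⟨hloa.trans hab, hbhi⟩
    have hsub : Icc lo hi ⊆ Icc (-hi) hi := Icc_subset_Icc (by linarith) le_rfl
    have hwGi : IntervalIntegrable (fun e => wt e * G e) volume a b :=
      ((hwc.mono ((uIcc_subset_Icc haI hbI).trans hsub)).mul hGc.continuousOn).intervalIntegrable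
    have hsum : (fun e => wt e * G e) = fun e => wt lo * G e + (wt e - wt lo) * G e := funext fun e => by ring
    have hvari : IntervalIntegrable (fun e => (wt e - wt lo) * G e) volume a b :=
      (hwGi.sub ((hGi a b).const_mul (wt lo))).congr fun e _ => by ring
    rw [hsum, intervalIntegral.integral_add ((hGi a b).const_mul (wt lo)) hvari, intervalIntegral.integral_const_mul]
    -- (II) the variation part
    have hII : |∫ e in a..b, (wt e - wt lo) * G e| ≤ 4 * c' * W' := by
      have hbound : ∀ e ∈ Ι a b, ‖(wt e - wt lo) * G e‖ ≤ W' * c' / D := fun e he => by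
        rw [uIoc_of_le hab] at he
        have he0 : 0 < e := ha0.trans he.1
        have heI : e ∈ Icc lo hi := ⟨hloa.trans he.1.le, he.2.trans hbhi⟩
        rw [Real.norm_eq_abs, abs_mul]
        have h1 : |wt e - wt lo| ≤ W' * e := (hwL e heI).trans (mul_le_mul_of_nonneg_left (by linarith) hW')
        have h2 : |G e| ≤ e⁻¹ ^ 2 :=
          (hG1 e he0).trans (pow_le_pow_left₀ (inv_nonneg.2 (he0.le.trans (le_max_left _ _))) (inv_anti₀ he0 (le_max_left _ _)) 2)
        have hae : D / c' ≤ e := hDa.trans he.1.le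
        calc |wt e - wt lo| * |G e| ≤ W' * e * e⁻¹ ^ 2 := mul_le_mul h1 h2 (abs_nonneg _) (by positivity)
          _ = W' / e := by field_simp
          _ ≤ W' / (D / c') := div_le_div_of_nonneg_left hW' (by positivity) hae
          _ = W' * c' / D := by field_simp
      have h := intervalIntegral.norm_integral_le_of_norm_le_const hbound
      rw [Real.norm_eq_abs, abs_of_nonneg (by linarith : 0 ≤ b - a)] at h
      refine h.trans ?_
      have hba : b - a ≤ 4 * D := by linarith
      calc W' * c' / D * (b - a) ≤ W' * c' / D * (4 * D) := mul_le_mul_of_nonneg_left hba (by positivity)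
        _ = 4 * c' * W' := by field_simp
    -- (I) the constant part
    have hI : |∫ e in a..b, G e| ≤ X * (lo / max D lo ^ 2) := by
      rw [← intervalIntegral.integral_congr hderiv']; exact hI0 hfwd
    have hconst : |wt lo * ∫ e in a..b, G e| ≤ W * X * (lo / max D lo ^ 2) := by
      rw [abs_mul, mul_assoc]; exact mul_le_mul (hwW lo hloI) hI (abs_nonneg _) hW0
    calc |wt lo * (∫ e in a..b, G e) + ∫ e in a..b, (wt e - wt lo) * G e|
        ≤ |wt lo * ∫ e in a..b, G e| + |∫ e in a..b, (wt e - wt lo) * G e| := abs_add_le _ _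
      _ ≤ W * X * (lo / max D lo ^ 2) + 4 * c' * W' := add_le_add hconst hII

end BandRow

end Summit.HubbardSuperconductivity.HubbardSuperconductivity.Theorems.C4a

end
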